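import Literature.GroupTheory.Nilpotent.PolynomialGrowthCollection
import Mathlib.Data.Set.Card
import Mathlib.Data.Set.Finite.List
import Mathlib.Data.List.FinRange
import Mathlib.SetTheory.Cardinal.Finite
import HarnessLib

/-!
# Polynomial growth of finitely generated nilpotent groups (Wolf 1968), II: bounded generation with
# polynomial exponents, and polynomial growth of word balls

J. A. Wolf, J. Differential Geometry 2 (1968) 421–446, Theorem 3.2 (upper bound): a finitely generated
nilpotent group has polynomial growth.  (Exact degree: H. Bass, Proc. LMS 25 (1972), Thm. 2 — not
reproduced; only the upper bound is.)  Everything is stated RELATIVE to a subgroup `S ≤ G` through Mathlib's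
relative lower central series `S.lowerCentralSeries` (so that it applies verbatim to a nilpotent subgroup of
finite index in file III): hypothesis `S.lowerCentralSeries c = ⊥`, generators `x : Fin r₀ → G` in `S`.

* §1 the letter evaluation `(l, b) ↦ [x_{l₁}⁻¹, [x_{l₂}⁻¹, …, x_b]]` (a `List.foldr`): it lies in
  `S.lowerCentralSeries (k + |l|)` when the `x i` lie in `S.lowerCentralSeries k`, vanishes from weight
  `c - k` on, and satisfies the swap identity of file I;
* §2 **bounded generation with polynomial exponents** (`exists_polynomial_normalForm`): there are
  `t₁, …, t_r ∈ S` and `C, D` with every word of length `≤ n` in the `x i` equal to `t₁^{e₁} ⋯ t_r^{e_r}`,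
  all `e_j ≤ C (n+1)^D` — by descending induction on the depth `k` in the lower central series, one
  collection (file I) per step;
* §3 **polynomial growth of word balls** (`ncard_wordBall_le_polynomial`): the number of values of words
  of length `≤ n` is `≤ C (n+1)^D`.

Topic `Literature/GroupTheory/Nilpotent`, namespace `Literature.GroupTheory.Nilpotent`; theorems only.
Lane `prim-bschramm`, seat p3 (class C2).
-/

namespace Literature.GroupTheory.Nilpotent

open scoped commutatorElement

variable {G : Type*} [Group G] {ι : Type*}

/-! ## §1 The iterated-commutator evaluation of letters -/

/-- **Grading**: if every `x i ∈ γ_k(S)` then the letter `(l, b)` evaluates into `γ_{k+|l|}(S)`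
(`[s⁻¹, γ_j] ≤ γ_{j+1}` for `s ∈ S`). [cite: WolfGrowth1968, §3 (proof of Thm. 3.2)] -/
theorem foldr_commutator_mem_lowerCentralSeries (S : Subgroup G) (x : ι → G) {k : ℕ}
    (hk : ∀ i, x i ∈ S.lowerCentralSeries k) (l : List ι) (b : ι) :
    l.foldr (fun i acc => ⁅(x i)⁻¹, acc⁆) (x b) ∈ S.lowerCentralSeries (k + l.length) := by
  induction l with
  | nil => simpa using hk b
  | cons i l ih =>
    have hxi : x i ∈ S := Subgroup.lowerCentralSeries_le_self S k (hk i)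
    rw [List.foldr_cons, List.length_cons, ← add_assoc, Subgroup.lowerCentralSeries_succ, ← inv_mem_iff,
      commutatorElement_inv]
    exact Subgroup.commutator_mem_commutator ih (inv_mem hxi)

/-- **Vanishing**: with `γ_c(S) = ⊥`, letters of weight `≥ c - k + 1` are trivial. [cite: WolfGrowth1968, §3 (proof of Thm. 3.2)] -/
theorem foldr_commutator_eq_one (S : Subgroup G) (x : ι → G) {k c : ℕ}
    (hk : ∀ i, x i ∈ S.lowerCentralSeries k) (hc : S.lowerCentralSeries c = ⊥) (l : List ι) (b : ι)
    (hl : c ≤ k + l.length) : l.foldr (fun i acc => ⁅(x i)⁻¹, acc⁆) (x b) = 1 := by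
  have h := Subgroup.lowerCentralSeries_antitone S hl (foldr_commutator_mem_lowerCentralSeries S x hk l b)
  rw [hc] at h
  exact Subgroup.mem_bot.1 h

/-- **Swap identity** `u · y = y · [y⁻¹, u] · u`. [cite: WolfGrowth1968, §3 (proof of Thm. 3.2)] -/
theorem foldr_commutator_swap (x : ι → G) (l : List ι) (b a : ι) :
    l.foldr (fun i acc => ⁅(x i)⁻¹, acc⁆) (x b) * x a =
      x a * (a :: l).foldr (fun i acc => ⁅(x i)⁻¹, acc⁆) (x b) * l.foldr (fun i acc => ⁅(x i)⁻¹, acc⁆) (x b) := by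
  rw [List.foldr_cons, commutatorElement_def]
  group

/-! ## §2 Bounded generation with polynomial exponents -/

/-- **Normal form with polynomially bounded exponents** (Wolf 1968, proof of Thm. 3.2): if `γ_c(S) = ⊥`
and `x₁, …, x_{r₀} ∈ γ_k(S)`, there are `t₁, …, t_r ∈ γ_k(S)` and constants `C, D` such that every word
of length `≤ n` in the `x i` equals `t₁^{e₁} ⋯ t_r^{e_r}` with all `e_j ≤ C (n+1)^D`.  Descending induction
on `k`: collect the generators (file I), the remaining letters are finitely many iterated commutators in
`γ_{k+1}(S)`. [cite: WolfGrowth1968, Thm. 3.2 (proof)] -/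
theorem exists_polynomial_normalForm (S : Subgroup G) {c : ℕ} (hc : S.lowerCentralSeries c = ⊥)
    (k : ℕ) (r₀ : ℕ) (x : Fin r₀ → G) (hx : ∀ i, x i ∈ S.lowerCentralSeries k) :
    ∃ (ts : List G) (C D : ℕ), (∀ t ∈ ts, t ∈ S.lowerCentralSeries k) ∧
      ∀ (n : ℕ) (w : List (Fin r₀)), w.length ≤ n →
        ∃ es : List ℕ, es.length = ts.length ∧ (∀ e ∈ es, e ≤ C * (n + 1) ^ D) ∧
          (w.map x).prod = (List.zipWith (fun t e => t ^ e) ts es).prod := by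
  -- descending induction on `k`, measured by `m` with `c ≤ k + m`
  suffices H : ∀ (m k : ℕ), c ≤ k + m → ∀ (r₀ : ℕ) (x : Fin r₀ → G), (∀ i, x i ∈ S.lowerCentralSeries k) →
      ∃ (ts : List G) (C D : ℕ), (∀ t ∈ ts, t ∈ S.lowerCentralSeries k) ∧
        ∀ (n : ℕ) (w : List (Fin r₀)), w.length ≤ n →
          ∃ es : List ℕ, es.length = ts.length ∧ (∀ e ∈ es, e ≤ C * (n + 1) ^ D) ∧
            (w.map x).prod = (List.zipWith (fun t e => t ^ e) ts es).prod from
    H c k (by omega) r₀ x hx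
  -- the trivial case `γ_k(S) = ⊥`
  have triv : ∀ (k : ℕ), c ≤ k → ∀ (r₀ : ℕ) (x : Fin r₀ → G), (∀ i, x i ∈ S.lowerCentralSeries k) →
      ∃ (ts : List G) (C D : ℕ), (∀ t ∈ ts, t ∈ S.lowerCentralSeries k) ∧
        ∀ (n : ℕ) (w : List (Fin r₀)), w.length ≤ n →
          ∃ es : List ℕ, es.length = ts.length ∧ (∀ e ∈ es, e ≤ C * (n + 1) ^ D) ∧
            (w.map x).prod = (List.zipWith (fun t e => t ^ e) ts es).prod := by
    intro k hk r₀ x hx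
    have hx1 : ∀ i, x i = 1 := fun i => by
      have h := Subgroup.lowerCentralSeries_antitone S hk (hx i)
      rw [hc] at h
      exact Subgroup.mem_bot.1 h
    refine ⟨[], 0, 0, by simp, fun n w _ => ⟨[], rfl, by simp, ?_⟩⟩
    rw [List.zipWith_nil_left, List.prod_nil, List.prod_eq_one]
    intro g hg
    rw [List.mem_map] at hg
    obtain ⟨i, -, rfl⟩ := hg
    exact hx1 i
  intro m
  induction m with
  | zero => intro k hk; exact triv k (by omega)
  | succ m ih =>
    intro k hk r₀ x hx
    by_cases hkc : c ≤ k
    · exact triv k hkc r₀ x hx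
    -- the letters and the collection of file I with cap `c' = c - k ≥ 1`
    set φ : List (Fin r₀) × Fin r₀ → G := fun p => p.1.foldr (fun i acc => ⁅(x i)⁻¹, acc⁆) (x p.2) with hφ
    have hswap : ∀ (l : List (Fin r₀)) (b a : Fin r₀), φ (l, b) * x a = x a * φ (a :: l, b) * φ (l, b) :=
      fun l b a => foldr_commutator_swap x l b a
    have hvan : ∀ (l : List (Fin r₀)) (b : Fin r₀), c - k ≤ l.length → φ (l, b) = 1 :=
      fun l b hl => foldr_commutator_eq_one S x hx hc l b (by omega)
    have hφ1 : ∀ a, φ ([], a) = x a := fun a => rfl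
    obtain ⟨A, E, hAE⟩ := exists_collect_list φ x (c - k) hswap hvan hφ1 r₀
    -- the finitely many letters of weight `2 … c - k`, indexed by `Fin r₁`
    set Λ := {p : List (Fin r₀) × Fin r₀ // 0 < p.1.length ∧ p.1.length < c - k} with hΛ
    haveI : Finite Λ := by
      haveI : Finite {l : List (Fin r₀) // l.length ≤ c - k} := (List.finite_length_le (Fin r₀) (c - k)).to_subtype
      refine Finite.of_injective
        (fun q : Λ => ((⟨q.1.1, q.2.2.le⟩ : {l : List (Fin r₀) // l.length ≤ c - k}), q.1.2)) ?_
      intro q q' h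
      simp only [Prod.mk.injEq, Subtype.mk.injEq] at h
      exact Subtype.ext (Prod.ext h.1 h.2)
    letI : Fintype Λ := Fintype.ofFinite Λ
    set r₁ := Fintype.card Λ with hr₁
    let eΛ : Λ ≃ Fin r₁ := Fintype.equivFin Λ
    set x₁ : Fin r₁ → G := fun j => φ (eΛ.symm j).1 with hx₁
    have hx₁ : ∀ j, x₁ j ∈ S.lowerCentralSeries (k + 1) := fun j => by
      have h := foldr_commutator_mem_lowerCentralSeries S x hx (eΛ.symm j).1.1 (eΛ.symm j).1.2
      exact Subgroup.lowerCentralSeries_antitone S (by have := (eΛ.symm j).2.1; omega) h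
    obtain ⟨ts₁, C₁, D₁, hts₁, hBG₁⟩ := ih (k + 1) (by omega) r₁ x₁ hx₁
    refine ⟨(List.finRange r₀).map x ++ ts₁, C₁ * (A + 1) ^ D₁ + 1, E * D₁ + 1, ?_, ?_⟩
    · intro t ht
      rw [List.mem_append, List.mem_map] at ht
      rcases ht with ⟨i, -, rfl⟩ | ht
      · exact hx i
      · exact Subgroup.lowerCentralSeries_antitone S (Nat.le_succ k) (hts₁ t ht)
    intro n w hw
    -- collect
    set W : List (List (Fin r₀) × Fin r₀) := w.map fun a => ([], a) with hW
    have hWlt : ∀ p ∈ W, p.1.length < c - k := by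
      intro p hp
      rw [hW, List.mem_map] at hp
      obtain ⟨a, -, rfl⟩ := hp
      simp only [List.length_nil]
      omega
    obtain ⟨es, W', hes, hesb, hprod, hlt', hnot, -, -, hlen'⟩ := hAE (List.finRange r₀) List.length_finRange W hWlt
    have hWlen : W.length = w.length := by rw [hW, List.length_map]
    have hWprod : (W.map φ).prod = (w.map x).prod := by rw [hW, List.map_map]; rfl
    -- every remaining letter has weight `≥ 2`
    have hpos : ∀ p ∈ W', 0 < p.1.length := by
      intro p hp
      rcases Nat.eq_zero_or_pos p.1.length with h0 | h0
      · exfalso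
        have hp1 : p.1 = [] := List.length_eq_zero_iff.1 h0
        have : ([], p.2) ∈ W' := by
          have e : p = ([], p.2) := Prod.ext hp1 rfl
          rwa [e] at hp
        exact hnot p.2 (List.mem_finRange p.2) this
      · exact h0
    -- the remaining word as a word over `Fin r₁`
    set w₁ : List (Fin r₁) := W'.attach.map fun q => eΛ ⟨q.1, hpos q.1 q.2, hlt' q.1 q.2⟩ with hw₁
    have hw₁prod : (w₁.map x₁).prod = (W'.map φ).prod := by
      rw [hw₁, List.map_map]
      have : (x₁ ∘ fun q : {q // q ∈ W'} => eΛ ⟨q.1, hpos q.1 q.2, hlt' q.1 q.2⟩) = fun q => φ q.1 := by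
        funext q
        show φ (eΛ.symm (eΛ _)).1 = φ q.1
        rw [Equiv.symm_apply_apply]
      rw [this, List.attach_map_val]
    have hw₁len : w₁.length ≤ A * (n + 1) ^ E := by
      rw [hw₁, List.length_map, List.length_attach]
      refine hlen'.trans ?_
      rw [hWlen]
      exact Nat.mul_le_mul_left _ (Nat.pow_le_pow_left (by omega) _)
    obtain ⟨es₁, hes₁, hes₁b, hprod₁⟩ := hBG₁ (A * (n + 1) ^ E) w₁ hw₁len
    refine ⟨es ++ es₁, ?_, ?_, ?_⟩
    · simp [hes, hes₁]
    · -- the bounds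
      have hpow : (n + 1) ^ (E * D₁) ≤ (n + 1) ^ (E * D₁ + 1) := Nat.pow_le_pow_right (Nat.succ_pos n) (Nat.le_succ _)
      have hone : 1 ≤ (n + 1) ^ (E * D₁ + 1) := Nat.one_le_pow _ _ (Nat.succ_pos n)
      have hn1 : n + 1 ≤ (n + 1) ^ (E * D₁ + 1) := by
        calc n + 1 = (n + 1) ^ 1 := (pow_one _).symm
          _ ≤ (n + 1) ^ (E * D₁ + 1) := Nat.pow_le_pow_right (Nat.succ_pos n) (by omega)
      intro e he
      rw [List.mem_append] at he
      rcases he with he | he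
      · have h1 : e ≤ n := (hesb e he).trans (by omega)
        calc e ≤ n + 1 := by omega
          _ ≤ (n + 1) ^ (E * D₁ + 1) := hn1
          _ = 1 * (n + 1) ^ (E * D₁ + 1) := (one_mul _).symm
          _ ≤ (C₁ * (A + 1) ^ D₁ + 1) * (n + 1) ^ (E * D₁ + 1) := Nat.mul_le_mul_right _ (by omega)
      · have h1 := hes₁b e he
        have h2 : A * (n + 1) ^ E + 1 ≤ (A + 1) * (n + 1) ^ E := by
          have : 1 ≤ (n + 1) ^ E := Nat.one_le_pow _ _ (Nat.succ_pos n)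
          nlinarith
        calc e ≤ C₁ * (A * (n + 1) ^ E + 1) ^ D₁ := h1
          _ ≤ C₁ * ((A + 1) * (n + 1) ^ E) ^ D₁ := Nat.mul_le_mul_left _ (Nat.pow_le_pow_left h2 _)
          _ = C₁ * (A + 1) ^ D₁ * (n + 1) ^ (E * D₁) := by rw [mul_pow, ← pow_mul]; ring
          _ ≤ (C₁ * (A + 1) ^ D₁ + 1) * (n + 1) ^ (E * D₁ + 1) :=
            Nat.mul_le_mul (Nat.le_succ _) hpow
    · rw [← hWprod, hprod, ← hw₁prod, hprod₁, List.zipWith_append, List.prod_append, List.zipWith_map_left]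
      rw [List.length_map, List.length_finRange, hes, List.length_finRange]

/-! ## §3 Polynomial growth of word balls -/

/-- Word balls are finite (images of the finite set of words of bounded length): the growth function is well defined. [cite: WolfGrowth1968, §3 (growth function)] -/
theorem wordBall_finite {κ : Type*} [Finite κ] (x : κ → G) (n : ℕ) :
    {g : G | ∃ w : List κ, w.length ≤ n ∧ (w.map x).prod = g}.Finite := by
  refine ((List.finite_length_le κ n).image fun w => (w.map x).prod).subset ?_
  rintro g ⟨w, hw, rfl⟩
  exact ⟨w, hw, rfl⟩

/-- **Wolf's theorem, word form** (1968, Thm. 3.2, upper bound): if `γ_c(S) = ⊥` and `x₁, …, x_{r₀} ∈ S`,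
the number of values of words of length `≤ n` in the `x i` is at most `C·(n+1)^D` for some constants
`C ≥ 1`, `D` (independent of `n`). [cite: WolfGrowth1968, Thm. 3.2] -/
theorem ncard_wordBall_le_polynomial (S : Subgroup G) {c : ℕ} (hc : S.lowerCentralSeries c = ⊥)
    {r₀ : ℕ} (x : Fin r₀ → G) (hx : ∀ i, x i ∈ S) :
    ∃ C D : ℕ, 1 ≤ C ∧ ∀ n : ℕ,
      {g : G | ∃ w : List (Fin r₀), w.length ≤ n ∧ (w.map x).prod = g}.ncard ≤ C * (n + 1) ^ D := by
  obtain ⟨ts, C, D, -, hBG⟩ := exists_polynomial_normalForm S hc 0 r₀ x (by simpa using hx)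
  refine ⟨(C + 1) ^ ts.length, D * ts.length, Nat.one_le_pow _ _ (Nat.succ_pos C), fun n => ?_⟩
  set B := C * (n + 1) ^ D with hB
  -- the ball is covered by the normal forms with exponents `≤ B`
  set F : (Fin ts.length → Fin (B + 1)) → G := fun f =>
    (List.zipWith (fun t e => t ^ e) ts (List.ofFn fun j => (f j : ℕ))).prod with hF
  have hcover : {g : G | ∃ w : List (Fin r₀), w.length ≤ n ∧ (w.map x).prod = g} ⊆ F '' Set.univ := by
    rintro g ⟨w, hw, rfl⟩
    obtain ⟨es, hes, hesb, hprod⟩ := hBG n w hw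
    set f : Fin ts.length → Fin (B + 1) := fun j =>
      ⟨es[j.val]'(by rw [hes]; exact j.2), Nat.lt_succ_of_le (hesb _ (List.getElem_mem _))⟩ with hf
    refine ⟨f, Set.mem_univ _, ?_⟩
    have hofFn : (List.ofFn fun j : Fin ts.length => ((f j : Fin (B + 1)) : ℕ)) = es := by
      apply List.ext_getElem
      · rw [List.length_ofFn, hes]
      · intro i h1 h2
        simp [hf]
    rw [hprod, hF]
    beta_reduce
    rw [hofFn]
  have hfin : (Set.univ : Set (Fin ts.length → Fin (B + 1))).Finite := Set.finite_univ
  calc {g : G | ∃ w : List (Fin r₀), w.length ≤ n ∧ (w.map x).prod = g}.ncard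
      ≤ (F '' Set.univ).ncard := Set.ncard_le_ncard hcover (hfin.image F)
    _ ≤ (Set.univ : Set (Fin ts.length → Fin (B + 1))).ncard := Set.ncard_image_le hfin
    _ = (B + 1) ^ ts.length := by
        rw [Set.ncard_univ, Nat.card_eq_fintype_card, Fintype.card_pi, Finset.prod_const, Fintype.card_fin,
          Finset.card_univ, Fintype.card_fin]
    _ ≤ ((C + 1) * (n + 1) ^ D) ^ ts.length := by
        apply Nat.pow_le_pow_left
        have : 1 ≤ (n + 1) ^ D := Nat.one_le_pow _ _ (Nat.succ_pos n)
        rw [hB]; nlinarith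
    _ = (C + 1) ^ ts.length * (n + 1) ^ (D * ts.length) := by rw [mul_pow, ← pow_mul]

/-- **Wolf's theorem, word form, for any finite family of elements of `S`** (re-indexing by `Fin r`).
[cite: WolfGrowth1968, Thm. 3.2] -/
theorem ncard_wordBall_le_polynomial' (S : Subgroup G) {c : ℕ} (hc : S.lowerCentralSeries c = ⊥)
    {κ : Type*} [Finite κ] (x : κ → G) (hx : ∀ i, x i ∈ S) :
    ∃ C D : ℕ, 1 ≤ C ∧ ∀ n : ℕ,
      {g : G | ∃ w : List κ, w.length ≤ n ∧ (w.map x).prod = g}.ncard ≤ C * (n + 1) ^ D := by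
  haveI : Fintype κ := Fintype.ofFinite κ
  set e := Fintype.equivFin κ
  obtain ⟨C, D, hC, h⟩ := ncard_wordBall_le_polynomial S hc (x ∘ e.symm) (fun i => hx _)
  refine ⟨C, D, hC, fun n => le_trans (Set.ncard_le_ncard ?_ (wordBall_finite _ n)) (h n)⟩
  rintro g ⟨w, hw, rfl⟩
  refine ⟨w.map e, by simpa using hw, ?_⟩
  rw [List.map_map]
  congr 2
  funext i
  simp

end Literature.GroupTheory.Nilpotent
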